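import Literature.MathematicalPhysics.QuantumFieldTheory.Balaban1983to89.HiggsFluctMeasureWickPairings

/-!
# `Balaban1983to89.HiggsFluctMeasureWickMomentBound` — J. Glimm, A. Jaffe, *Quantum Physics* (2nd ed., 1987) [GlimmJaffeQP1987]
(8.2.4) §8.2 *"∫φ(f₁)⋯φ(f_r)dφ_C = Σ_{pairings}(f_{i₁},f_{i₂})_C⋯(f_{i_{r−1}},f_{i_r})_C"*, *"The sum in (8.2.4) extends over the
(r−1)(r−3)(r−5)⋯1 = (r−1)!! distinct ways of choosing the pairs"*; T. Bałaban, *(Higgs)₂,₃ quantum fields in a finite volume*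
III [Balaban1983Higgs3] p. 414 *"divided into pairs and each pair is replaced by the corresponding propagator"* — **THE GAUSSIAN
PRODUCT-MOMENT BOUND `|⟨Π_{i=1}^{r} X_i⟩| ≤ (r−1)!!·Π_i σ_i`**: each of the `(r−1)!!` pairing terms is dominated, through the
Cauchy–Schwarz inequality for the covariance, by the product of the standard deviations of the legs; for the typer's pairing
sum `wickSum`, for p13's finite-dimensional Gaussian `gexp A 0`, and for the fluctuation measure `dμ_{C^{(j),L^jη}}` of (I.2.30).

statement-level skeleton of published theorems with citation tags; proofs where landed; nothing here is a claim about the Yang–Mills mass gap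

CITATION HEADER (lean-in-tree rule).  lit-balaban typed skeleton (HOME `run/shared/lean/pub/lit-balaban/`), typer line, unit
`lit-balaban-typer` gen 35 (`literature-prover-lit-balaban-typer-g35-0`); a LEAF on top of the typer's `HiggsFluctMeasureWickPairings`
(p399046 ✓).  Located member of the SKELETON rows **B3.Eq1.4** / **B3.Eq1.12-1.15** (p. 414 propagator paragraph; fold owner r15) and
**B1.Eq2.30** (the covariance `C^{(k)}`, fold owner r14) — CELLS ONLY, zero head weight.  USED BY NAME, nothing re-declared or
edited: the typer's `HiggsFluctMeasureWickSum.{wickSum, integral_prodLegs_eq_wickSum}`, `HiggsFluctMeasureWickPairings.{pairPartitions,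
pairVal, wickSum_eq_sum_pairPartitions_pairVal, card_pairPartitions, card_pairPartitions_of_odd, gexp_prod_legs_eq_wickSum,
integral_siteInner_pow_two_mul}`, `HiggsFluctMeasureCov.siteInner_fluctCov_comm`, `HiggsFluctMeasurePos.siteInner_*` (algebra of
(I.1.5)); p13's `Probability.LatticeModels.IsSetPartition` (`HardCoreUrsell`) and `BIJ88TruncationConnected306.gexp`; Mathlib's
`Matrix.PosDef.inv`, `Matrix.PosSemidef.dotProduct_mulVec_nonneg`, `discrim_le_zero`.

THE SOURCE TEXTS.  Glimm–Jaffe §8.2 (held text `book:glimm1987-quantum-physics-functional-integral-point-view-2nd`, chunks p0133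
L31–37 and p0134 L1, read this session) as quoted in the title; Bałaban III p. 414 [PDF 4] as quoted in `HiggsFluctMeasureWickSum`;
I (2.30) p. 611 (the covariance `C^{(k)}`, the typer's `HiggsFluctMeasure.fluctCov`).  The bound itself is the immediate
consequence of these two printed statements and the Cauchy–Schwarz inequality (tagged `[folklore]` below).

WHAT THIS FILE PROVES (kernel-checked, zero `sorry`, standard axioms; theorems only, no definition, no `Prop`-valued fact).
* §1 GENERIC (linearly ordered legs): `prod_prod_eq_of_isSetPartition`; `abs_prod_pairVal_le` (one pairing: `|Π_{B∈π} pairVal C B| ≤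
  Π_{i∈s} c_i` whenever `|C a b| ≤ c_a·c_b` on the pairs of `s`); **`abs_wickSum_le_card_mul_prod`** (`|wickSum C s| ≤
  |pairPartitions s|·Π c_i`); **`abs_wickSum_le_doubleFactorial_mul_prod`** (`|wickSum C s| ≤ (|s|−1)‼·Π_{i∈s} c_i`, `c ≥ 0`);
  **`abs_le_sqrt_mul_sqrt_of_quadratic`** (Cauchy–Schwarz for a nonnegative symmetric form, discriminant).
* §2 p13's GAUSSIAN (`A` positive definite; leg index types in `Type`): `inv_mulVec_dotProduct_comm`, `inv_mulVec_dotProduct_self_nonneg`,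
  `abs_inv_mulVec_dotProduct_le` (`|⟨A⁻¹v,w⟩| ≤ ⟨A⁻¹v,v⟩^{1/2}⟨A⁻¹w,w⟩^{1/2}`), **`abs_gexp_prod_legs_le`** (`|⟨Π_{l∈T} Φ·v_l⟩| ≤
  (|T|−1)‼·Π_l ⟨A⁻¹v_l, v_l⟩^{1/2}`).
* §3 THE FLUCTUATION MEASURE `dμ_{C^{(j),L^jη}}` (`msq > 0`, `a > 0`, `L > 1`, `j ≤ K`): **`siteInner_fluctCov_self_nonneg`**
  (`0 ≤ ⟨f, C^{(j)}f⟩ = ∫⟨A′,f⟩²dμ`), **`abs_siteInner_fluctCov_le`** (Cauchy–Schwarz for `C^{(j)}`), **`abs_integral_prodLegs_le`**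
  (`|∫ Π_{i∈s}⟨A′,f_i⟩ dμ_{C^{(j)}}| ≤ (|s|−1)‼·Π_{i∈s} ⟨f_i, C^{(j)}f_i⟩^{1/2}`).
HONEST SCOPE.  An elementary consequence of the pairing form of Wick's theorem; no claim that this crude bound (no decay between
distinct legs) is the one the papers use — the cluster-expansion estimates of the cell (e.g. r14's `B1Eq323ConnectedGraphBound`) keep
the decay of the propagators; this file only records the standard local bound with its `(r−1)!!`.  Rows keep their heads; NOT summit
progress; NOT Clay.
-/

open Finset
open scoped BigOperators Nat

namespace Literature.MathematicalPhysics.QuantumFieldTheory.Balaban1983to89.HiggsFluctMeasureWickMomentBound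

open Literature.Probability.LatticeModels (setPartitions IsSetPartition mem_setPartitions)
open HiggsFluctMeasureWickSum (wickSum)
open HiggsFluctMeasureWickPairings (pairPartitions mem_pairPartitions pairVal pairVal_pair pairVal_of_card_ne_two
  wickSum_eq_sum_pairPartitions_pairVal card_pairPartitions card_pairPartitions_of_odd)

noncomputable section

/-! ## §1 The pairing sum is dominated by `(number of pairings) × Π_i c_i` when `|C a b| ≤ c_a·c_b` -/

section Generic

variable {ι : Type*} [LinearOrder ι]

/-- Over a set partition `π` of `s`, `∏_{B ∈ π} ∏_{i ∈ B} c i = ∏_{i ∈ s} c i` (p33's `prod_prod_of_isSetPartition`, restated here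
to keep the import light). [folklore] [cite: GlimmJaffeQP1987, (8.2.4) §8.2] -/
theorem prod_prod_eq_of_isSetPartition (c : ι → ℝ) {s : Finset ι} {π : Finset (Finset ι)} (hπ : IsSetPartition s π) :
    ∏ B ∈ π, ∏ i ∈ B, c i = ∏ i ∈ s, c i := by
  have h := prod_biUnion (s := π) (t := id) (f := c) hπ.pairwiseDisjoint
  rw [hπ.biUnion_id] at h
  rw [h]
  rfl

/-- One pairing term: if `|C a b| ≤ c a · c b` for the pairs `a < b` of `s` (and `c ≥ 0` on `s`), then for every pair partition `π`
of `s`, `|Π_{B∈π} pairVal C B| ≤ Π_{i∈s} c i` (no sign condition on `c` is needed: a pair partition covers every leg exactly once). [folklore] [cite: GlimmJaffeQP1987, (8.2.4) §8.2] -/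
theorem abs_prod_pairVal_le {C : ι → ι → ℝ} {c : ι → ℝ} {s : Finset ι}
    (hC : ∀ a ∈ s, ∀ b ∈ s, a < b → |C a b| ≤ c a * c b)
    {π : Finset (Finset ι)} (hπ : π ∈ pairPartitions s) :
    |∏ B ∈ π, pairVal C B| ≤ ∏ i ∈ s, c i := by
  obtain ⟨hsp, h2⟩ := mem_pairPartitions.1 hπ
  rw [Finset.abs_prod, ← prod_prod_eq_of_isSetPartition c hsp]
  refine prod_le_prod (fun B _ => abs_nonneg _) fun B hB => ?_
  have hBs : B ⊆ s := hsp.subset hB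
  obtain ⟨x, y, hxy, rfl⟩ := card_eq_two.1 (h2 B hB)
  have hx : x ∈ s := hBs (mem_insert_self _ _)
  have hy : y ∈ s := hBs (mem_insert_of_mem (mem_singleton_self _))
  rw [prod_pair hxy]
  rcases lt_or_gt_of_ne hxy with hl | hl
  · rw [pairVal_pair _ hl]
    exact hC x hx y hy hl
  · rw [pair_comm, pairVal_pair _ hl, mul_comm]
    exact hC y hy x hx hl

/-- **THE PAIRING SUM IS AT MOST (NUMBER OF PAIRINGS) × `Π_i c_i`** when every pair propagator is dominated by a product,
`|C a b| ≤ c_a·c_b` (`a < b` in `s`): `|wickSum C s| ≤ |pairPartitions s|·Π_{i∈s} c i`.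
[folklore] [cite: GlimmJaffeQP1987, (8.2.4) §8.2] -/
theorem abs_wickSum_le_card_mul_prod {C : ι → ι → ℝ} {c : ι → ℝ} {s : Finset ι}
    (hC : ∀ a ∈ s, ∀ b ∈ s, a < b → |C a b| ≤ c a * c b) :
    |wickSum C s| ≤ (pairPartitions s).card * ∏ i ∈ s, c i := by
  rw [wickSum_eq_sum_pairPartitions_pairVal]
  calc |∑ π ∈ pairPartitions s, ∏ B ∈ π, pairVal C B|
      ≤ ∑ π ∈ pairPartitions s, |∏ B ∈ π, pairVal C B| := abs_sum_le_sum_abs _ _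
    _ ≤ ∑ π ∈ pairPartitions s, ∏ i ∈ s, c i := sum_le_sum fun π hπ => abs_prod_pairVal_le hC hπ
    _ = (pairPartitions s).card * ∏ i ∈ s, c i := by rw [sum_const, nsmul_eq_mul]

/-- **`|wickSum C s| ≤ (|s| − 1)‼·Π_{i∈s} c i`** (Glimm–Jaffe §8.2: the sum (8.2.4) has `(r−1)!!` terms; for `|s|` odd the left
side is `0`). [folklore] [cite: GlimmJaffeQP1987, (8.2.4) §8.2] -/
theorem abs_wickSum_le_doubleFactorial_mul_prod {C : ι → ι → ℝ} {c : ι → ℝ} {s : Finset ι}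
    (hC : ∀ a ∈ s, ∀ b ∈ s, a < b → |C a b| ≤ c a * c b) (hc : ∀ a ∈ s, 0 ≤ c a) :
    |wickSum C s| ≤ ((s.card - 1)‼ : ℕ) * ∏ i ∈ s, c i := by
  refine (abs_wickSum_le_card_mul_prod hC).trans (mul_le_mul_of_nonneg_right ?_ (prod_nonneg hc))
  rcases Nat.even_or_odd s.card with he | ho
  · rw [card_pairPartitions he]
  · rw [card_pairPartitions_of_odd ho]
    exact_mod_cast Nat.zero_le _

/-- **Cauchy–Schwarz for a nonnegative symmetric form** (discriminant): if `t ↦ Q(x + t·y) = Q x x + 2t·Q x y + t²·Q y y` and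
`Q z z ≥ 0` for all `z`, then `|Q x y| ≤ √(Q x x)·√(Q y y)` — so a covariance is dominated by the product of the standard
deviations, the hypothesis of `abs_wickSum_le_doubleFactorial_mul_prod`. [folklore] [cite: GlimmJaffeQP1987, (8.2.4) §8.2] -/
theorem abs_le_sqrt_mul_sqrt_of_quadratic {V : Type*} [AddCommGroup V] [Module ℝ V] (Q : V → V → ℝ) (x y : V)
    (hexp : ∀ t : ℝ, Q (x + t • y) (x + t • y) = Q x x + 2 * t * Q x y + t ^ 2 * Q y y) (hnn : ∀ z, 0 ≤ Q z z) :
    |Q x y| ≤ Real.sqrt (Q x x) * Real.sqrt (Q y y) := by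
  have hdisc : discrim (Q y y) (2 * Q x y) (Q x x) ≤ 0 := by
    refine discrim_le_zero fun t => ?_
    have h := hnn (x + t • y)
    rw [hexp] at h
    nlinarith [h]
  rw [discrim] at hdisc
  have hxx := hnn x
  have hyy := hnn y
  have hsq : (Q x y) ^ 2 ≤ Q x x * Q y y := by nlinarith [hdisc]
  rw [← Real.sqrt_mul hxx, ← Real.sqrt_sq_eq_abs]
  exact Real.sqrt_le_sqrt hsq

end Generic

/-! ## §2 p13's finite-dimensional Gaussian: `|⟨Π_{l∈T} Φ·v_l⟩| ≤ (|T|−1)‼·Π_l ⟨A⁻¹v_l, v_l⟩^{1/2}` -/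

section Engine

open Matrix
open Literature.MathematicalPhysics.QuantumFieldTheory.BalabanImbrieJaffe1984to88
open BIJ88TruncationConnected306 (gexp)
open HiggsFluctMeasureWickPairings (gexp_prod_legs_eq_wickSum)

variable {S : Type} [Fintype S] [DecidableEq S] {A : Matrix S S ℝ} {Λ : Type} [LinearOrder Λ]

/-- The covariance `A⁻¹` of p13's Gaussian is a symmetric form: `⟨A⁻¹v, w⟩ = ⟨A⁻¹w, v⟩`.
[cite: GlimmJaffeQP1987, (8.2.4) §8.2] -/
theorem inv_mulVec_dotProduct_comm (hA : A.PosDef) (v w : S → ℝ) :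
    (A⁻¹ *ᵥ v) ⬝ᵥ w = (A⁻¹ *ᵥ w) ⬝ᵥ v := by
  have hs : (A⁻¹)ᵀ = A⁻¹ := by
    have h := hA.inv.isHermitian
    rw [Matrix.IsHermitian, Matrix.conjTranspose_eq_transpose_of_trivial] at h
    exact h
  rw [dotProduct_comm, dotProduct_mulVec, ← mulVec_transpose, hs]

/-- The covariance is nonnegative: `0 ≤ ⟨A⁻¹v, v⟩`. [cite: GlimmJaffeQP1987, (8.2.4) §8.2] -/
theorem inv_mulVec_dotProduct_self_nonneg (hA : A.PosDef) (v : S → ℝ) : 0 ≤ (A⁻¹ *ᵥ v) ⬝ᵥ v := by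
  have h := hA.inv.posSemidef.dotProduct_mulVec_nonneg v
  rw [dotProduct_comm]
  simpa using h

/-- **Cauchy–Schwarz for the covariance**: `|⟨A⁻¹v, w⟩| ≤ ⟨A⁻¹v,v⟩^{1/2}·⟨A⁻¹w,w⟩^{1/2}`. [cite: GlimmJaffeQP1987, (8.2.4) §8.2] -/
theorem abs_inv_mulVec_dotProduct_le (hA : A.PosDef) (v w : S → ℝ) :
    |(A⁻¹ *ᵥ v) ⬝ᵥ w| ≤ Real.sqrt ((A⁻¹ *ᵥ v) ⬝ᵥ v) * Real.sqrt ((A⁻¹ *ᵥ w) ⬝ᵥ w) := by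
  refine abs_le_sqrt_mul_sqrt_of_quadratic (fun v w => (A⁻¹ *ᵥ v) ⬝ᵥ w) v w (fun t => ?_)
    (inv_mulVec_dotProduct_self_nonneg hA)
  simp only [mulVec_add, mulVec_smul, add_dotProduct, dotProduct_add, smul_dotProduct, dotProduct_smul, smul_eq_mul]
  rw [inv_mulVec_dotProduct_comm hA w v]
  ring

/-- **GAUSSIAN PRODUCT-MOMENT BOUND** for p13's finite-dimensional Gaussian `e^{−½⟨Φ,AΦ⟩}dΦ`: `|⟨Π_{l∈T} Φ·v_l⟩| ≤
(|T| − 1)‼·Π_{l∈T} ⟨A⁻¹v_l, v_l⟩^{1/2}` — the `(|T|−1)‼` pairings of (8.2.4), each dominated through Cauchy–Schwarz by the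
product of the standard deviations of the legs. [cite: GlimmJaffeQP1987, (8.2.4) §8.2] -/
theorem abs_gexp_prod_legs_le (hA : A.PosDef) (v : Λ → S → ℝ) (T : Finset Λ) :
    |gexp A 0 (fun Φ => ∏ l ∈ T, Φ ⬝ᵥ v l)| ≤ ((T.card - 1)‼ : ℕ) * ∏ l ∈ T, Real.sqrt ((A⁻¹ *ᵥ v l) ⬝ᵥ v l) := by
  rw [gexp_prod_legs_eq_wickSum hA v T]
  exact abs_wickSum_le_doubleFactorial_mul_prod (fun a _ b _ _ => abs_inv_mulVec_dotProduct_le hA (v a) (v b))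
    (fun a _ => Real.sqrt_nonneg _)

end Engine

/-! ## §3 The fluctuation measure `dμ_{C^{(j),L^jη}}`: `|∫ Π_{i∈s}⟨A′,f_i⟩ dμ| ≤ (|s|−1)‼·Π_i ⟨f_i, C^{(j)}f_i⟩^{1/2}` -/

section Fluct

open _root_.MeasureTheory
open HiggsLattice B3MultiscaleFields HiggsFluctMeasure HiggsFluctMeasurePos
open HiggsFluctMeasureCov (siteInner_fluctCov_comm)
open HiggsFluctMeasureWickSum (integral_prodLegs_eq_wickSum)
open HiggsFluctMeasureWickPairings (integral_siteInner_pow_two_mul)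

variable {P : HiggsLattice.Params} {msq a : ℝ} {j : ℕ}

/-- **The covariance `C^{(j),L^jη}` is nonnegative**: `0 ≤ ⟨f, C^{(j)}f⟩ = ∫⟨A′,f⟩² dμ_{C^{(j)}}` (`msq > 0`, `a > 0`, `L > 1`,
`j ≤ K`; the second moment of one leg). [cite: Balaban1982Higgs1, (2.30) p.611] -/
theorem siteInner_fluctCov_self_nonneg (hmsq : 0 < msq) (ha : 0 < a) (hL : 1 < (P.L : ℝ)) (hj : j ≤ P.K)
    (f : HiggsLattice.VecField P j) : 0 ≤ siteInner (toSite f) (fluctCov P msq a j (toSite f)) := by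
  have h := integral_siteInner_pow_two_mul hmsq ha hL hj f 1
  rw [pow_one, show ((2 * 1 - 1)‼ : ℕ) = 1 from rfl, Nat.cast_one, one_mul] at h
  rw [← h]
  exact integral_nonneg fun A => (even_two_mul 1).pow_nonneg _

/-- **Cauchy–Schwarz for the covariance `C^{(j),L^jη}`**: `|⟨g, C^{(j)}f⟩| ≤ ⟨f,C^{(j)}f⟩^{1/2}·⟨g,C^{(j)}g⟩^{1/2}` for bond
functions `f, g` (symmetry `siteInner_fluctCov_comm` + nonnegativity). [cite: Balaban1982Higgs1, (2.30) p.611] -/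
theorem abs_siteInner_fluctCov_le (hmsq : 0 < msq) (ha : 0 < a) (hL : 1 < (P.L : ℝ)) (hj : j ≤ P.K)
    (f g : HiggsLattice.VecField P j) :
    |siteInner (toSite g) (fluctCov P msq a j (toSite f))|
      ≤ Real.sqrt (siteInner (toSite f) (fluctCov P msq a j (toSite f)))
        * Real.sqrt (siteInner (toSite g) (fluctCov P msq a j (toSite g))) := by
  have key := abs_le_sqrt_mul_sqrt_of_quadratic
    (fun F G : HiggsLattice.VecField P j => siteInner (toSite G) (fluctCov P msq a j (toSite F))) f g (fun t => ?_)
    (fun F => siteInner_fluctCov_self_nonneg hmsq ha hL hj F)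
  · simpa using key
  · have hadd_left : ∀ u v w : ScalarField P j P.d, siteInner (u + v) w = siteInner u w + siteInner v w :=
      fun u v w => by
        rw [HiggsFluctMeasurePos.siteInner_comm, HiggsFluctMeasurePos.siteInner_add_right,
          HiggsFluctMeasurePos.siteInner_comm w u, HiggsFluctMeasurePos.siteInner_comm w v]
    simp only [toSite_add, toSite_smul, map_add, map_smul]
    rw [hadd_left, HiggsFluctMeasurePos.siteInner_add_right, HiggsFluctMeasurePos.siteInner_add_right,
      HiggsFluctMeasurePos.siteInner_smul_left, HiggsFluctMeasurePos.siteInner_smul_left,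
      HiggsFluctMeasurePos.siteInner_smul_right, HiggsFluctMeasurePos.siteInner_smul_right,
      siteInner_fluctCov_comm msq a j (toSite f) (toSite g)]
    ring

/-- **GAUSSIAN PRODUCT-MOMENT BOUND FOR `dμ_{C^{(j),L^jη}}`**: `|∫ Π_{i∈s}⟨A′,f_i⟩ dμ_{C^{(j)}}| ≤ (|s|−1)‼·Π_{i∈s}
⟨f_i, C^{(j)}f_i⟩^{1/2}` (`msq > 0`, `a > 0`, `L > 1`, `j ≤ K`) — the `(|s|−1)‼` pairings of the legs (p. 414 *"divided into
pairs"*), each dominated by the product of the standard deviations. [cite: Balaban1983Higgs3, (1.4) p.414] -/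
theorem abs_integral_prodLegs_le (hmsq : 0 < msq) (ha : 0 < a) (hL : 1 < (P.L : ℝ)) (hj : j ≤ P.K) {ι : Type*}
    [LinearOrder ι] (f : ι → HiggsLattice.VecField P j) (s : Finset ι) :
    |∫ A, ∏ i ∈ s, siteInner (toSite A) (toSite (f i)) ∂(fluctMeasure P msq a j)|
      ≤ ((s.card - 1)‼ : ℕ) * ∏ i ∈ s, Real.sqrt (siteInner (toSite (f i)) (fluctCov P msq a j (toSite (f i)))) := by
  rw [integral_prodLegs_eq_wickSum hmsq ha hL hj f s]
  exact abs_wickSum_le_doubleFactorial_mul_prod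
    (fun a' _ b' _ _ => abs_siteInner_fluctCov_le hmsq ha hL hj (f a') (f b')) (fun _ _ => Real.sqrt_nonneg _)

end Fluct

end

end Literature.MathematicalPhysics.QuantumFieldTheory.Balaban1983to89.HiggsFluctMeasureWickMomentBound
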